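import Summits.QuantumFields.BalabanUV.Beta.SpineRecursiveWEnd

/-!
# `BalabanUV.Beta.SpineRecursiveWEndRem` — binder row D1, (L4) piece (W-ASM) WITH A REMAINDER SLOT IN THE SECOND-ORDER LETTER: **hR FOR THE
# W-INSTANTIATED RECURSIVE WALL FAMILY `JsRecWAtOf` ⟸ (hT2-rem) ∧ (hM2) ∧ (hsplit)+Loc ∧ (hΔ0)** — the induction-compatible socket
# (β sub-cell, row BETA-an2 = BINDER-OWNERS row D1 OWNER, lineage an2 gen 18; memo `SKELETON-D1-L4` v2)

HONEST FRAMING (cell charter, verbatim): «discharging BetaPertH makes Balaban's UV stability UNCONDITIONAL — a real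
constructive-QFT result; it is NOT the continuum limit and NOT the Clay problem.»  DERIVED cell leaf: no statement of Bałaban's papers is typed
here, no `[cite:]` tag, no `def`, no `Prop` fact; instantiates no binder of the wall by itself.  NOT D1, NOT `BetaPertH`, NOT continuum, NOT Clay.

WHY.  The level induction for the second-order letter law (W-E) produces, at level `j+1`, a ♯-bi-table of similarity shape UP TO A DISPLAYED
REMAINDER (`SecondOrderStepLaw.quarticStep_bref_of_laws`: `−a • mmRead R₀ + RB + conjV (mmRead G) (diagK …)`), row-parity-odd hence tadpole-null
against `G_{j+1}` — not of pure similarity shape.  The (W-ASM) root `SpineRecursiveWEnd.axisReflectionCovariant_flipK_TbalOf_JsRecWAtOf` asks for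
the pure shape in (hT2); this file restates it with a remainder slot `R2 j α κ u κ′ u′` threaded through (hT2) and the `S₂♯` argument of (hsplit).
The split identity (hsplit) with its residual family `Δ` stays the user's (for these ♯-tables: an2-g17's `SecondOrderContactAssembly.W2OfK_sharp_split`
plus `vertex2OfK`-additivity, `Δ b c = dM (Ξ c) N S M b + vertex2OfK G_j Lc (R2 j α) b c`), as do (hΔL) and (hΔ0) (leaf-05's parity toolkit).
The proof is the v1 proof VERBATIM (the transport `W2SymOfK_bref_sharp` and the symmetrisation `W2SymOfK_sharp_split_of` are agnostic of the
♯-tables' shape).  Provenance: β sub-cell, unit beta-an2 gen 18, 2026-08-20 (v1); imports `SpineRecursiveWEnd` for its §1 bricks; no existing file touched.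
-/

open Finset
open scoped BigOperators
open Literature.MathematicalPhysics.QuantumFieldTheory
open Literature.MathematicalPhysics.QuantumFieldTheory.Balaban1983to89
open Literature.MathematicalPhysics.QuantumFieldTheory.Balaban1983to89.Beta
open ExpKernelCalculus (MKer Decays BiLoc comp tadpole VertexFamily VertexFamily₂ shiftK)
open AffineAveraging (box toSite)
open AveragingContoursRooted (ctr ctrOff ctrOff_mem_box)
open PolarizationSign (reflSign AxisReflectionCovariant)
open KernelReflection (refK refK_apply)
open ResolventReflection (bref Φ)
open OneStepResolventKernel (Fib LocStencil JetData wsum)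
open OneStepKernelFamily (KInvStep colH vertexOfK TbalOf flipK)
open BalabanStepJetsSucc (wE wVH)
open BalabanCompositeJets (LocStencil₂)
open BalabanStepW2 (M2Of)
open SecondOrderResponse (dM W2OfK W2SymOfK LocStencilFM)
open Summit.QuantumFields.BalabanUV.Beta.TameKernelCalculus
open Summit.QuantumFields.BalabanUV.Beta.ChartConjugation (conjV conjW loc_conjV)
open Summit.QuantumFields.BalabanUV.Beta.ChartConjugationRelative (RelInv)
open Summit.QuantumFields.BalabanUV.Beta.AxialDressingRooted (coDressKBmAt axEc spr_axEc one_le_of_neZero refK_coDressKBmAt_KInvStep)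
open Summit.QuantumFields.BalabanUV.Beta.BorderedHessian (diagK diagK_apply ctGen comp_axEc_diagK_comm bhKStepAt stepScale spr_bhKStepAt
  relInv_coDressKBmAt_KInvStep_bhKStepAt)
open Summit.QuantumFields.BalabanUV.Beta.WardLocusRecursive (SrecAt SrecAt_zero)
open Summit.QuantumFields.BalabanUV.Beta.VertexReflectionContact (smul_diagK)
open Summit.QuantumFields.BalabanUV.Beta.SecondOrderTransport (W2SymOfK_bref_sharp)
open Summit.QuantumFields.BalabanUV.Beta.SecondOrderSymContact (W2SymOfK_sharp_split_of tadpole_conjV_rel_eq_zero tadpole_rem_eq_zero loc_rem)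
open Summit.QuantumFields.BalabanUV.Beta.LagrangeFoldSrec (vertexOfK_S0NAt_split vertexOfK_SrecAt_succ_split)

noncomputable section

namespace Summit.QuantumFields.BalabanUV.Beta.SpineRooted

section Wall

variable {Lc : ℕ} [NeZero Lc]

/-- [folklore] **hR FOR `JsRecWAtOf` ⟸ THE SECOND-ORDER LETTERS WITH A REMAINDER SLOT + THE ASSEMBLED SPLIT + THE RESIDUAL'S LOCALISATION AND
TADPOLE** — `SpineRecursiveWEnd.axisReflectionCovariant_flipK_TbalOf_JsRecWAtOf` with the ♯-bi-table of `T2RecAt j` of similarity shape UP TO A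
REMAINDER `R2 j α κ u κ′ u′` (hypothesis (hT2) and the `S₂♯` argument of (hsplit) carry `+ R2 …`; the residual family `Δ` of (hsplit) is the user's —
for the similarity letters plus `R2` it is `dM (Ξ c) … b + vertex2OfK G_j Lc (R2 j α) b c`, whose localisation (hΔL) and tadpole-nullity (hΔ0) are then
the user's two obligations).  Every hypothesis is a BINDER, discharged by nothing in this file; the proof is the v1 proof verbatim. -/
theorem axisReflectionCovariant_flipK_TbalOf_JsRecWAtOf_rem (hLc : Odd Lc) (cΛ cE₂ cB : ℝ) (T : Fin 4 → Fin 4 → Fin 4 → Fin 4 → ℝ)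
    {vh₂S : Fin 4 → (Fin 4 → ℤ) → Fin 4 → (Fin 4 → ℤ) → MKer 4 (Fib 3)} (hB : ∃ C δ : ℝ, 0 < δ ∧ LocStencil₂ vh₂S C δ)
    {mixFF : Fin 4 → (Fin 4 → ℤ) → Fin 4 → (Fin 4 → ℤ) → MKer 4 (Fib 3)} (hmix : ∃ C δ : ℝ, 0 < δ ∧ LocStencilFM Lc mixFF C δ)
    (hBt : ∀ (κ : Fin 4) (u : Fin 4 → ℤ) (κ' : Fin 4) (u' t : Fin 4 → ℤ),
      vh₂S κ (u + (Lc : ℤ) • t) κ' (u' + (Lc : ℤ) • t) = shiftK (-((Lc : ℤ) • t)) (vh₂S κ u κ' u'))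
    (hmixt : ∀ (κ : Fin 4) (u : Fin 4 → ℤ) (μ : Fin 4) (w t : Fin 4 → ℤ),
      mixFF κ (u + (Lc : ℤ) • t) μ (w + t) = shiftK (-((Lc : ℤ) • t)) (mixFF κ u μ w))
    (γ : ℕ → ℝ) (hγ : ∀ j, γ j = -((Lc : ℝ) ^ 8 / 2) * wVH 3 Lc j / (stepScale 3 Lc j * (Lc : ℝ) ^ 4))
    (h : ℕ → Fin 4 → Fin 4 → (Fin 4 → ℤ) → Fin 4 → (Fin 4 → ℤ) → (Fin 4 → ℤ) → Fib 3 → ℝ)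
    (R2 : ℕ → Fin 4 → Fin 4 → (Fin 4 → ℤ) → Fin 4 → (Fin 4 → ℤ) → MKer 4 (Fib 3))
    (hT2 : ∀ (j : ℕ) (α κ : Fin 4) (u : Fin 4 → ℤ) (κ' : Fin 4) (u' : Fin 4 → ℤ),
      T2RecAt 3 Lc (toSite (ctrOff 4 Lc)) ((Lc : ℝ) ^ 4) (-((Lc : ℝ) ^ 8 / 2)) cΛ cE₂ cB T vh₂S mixFF j κ (bref α κ u) κ' (bref α κ' u') =
        (reflSign α κ * reflSign α κ') • refK (Φ Lc α)
          (T2RecAt 3 Lc (toSite (ctrOff 4 Lc)) ((Lc : ℝ) ^ 4) (-((Lc : ℝ) ^ 8 / 2)) cΛ cE₂ cB T vh₂S mixFF j κ u κ' u' +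
            conjW (bhKStepAt 3 (toSite (ctrOff 4 Lc)) Lc j)
              (SpureRecAt 3 Lc (toSite (ctrOff 4 Lc)) ((Lc : ℝ) ^ 4) (-((Lc : ℝ) ^ 8 / 2)) cΛ j κ u)
              (SpureRecAt 3 Lc (toSite (ctrOff 4 Lc)) ((Lc : ℝ) ^ 4) (-((Lc : ℝ) ^ 8 / 2)) cΛ j κ' u')
              (diagK fun p c => γ j * ctGen 3 α Lc κ u p c) (diagK fun p c => γ j * ctGen 3 α Lc κ' u' p c) (diagK (h j α κ u κ' u')) +
            R2 j α κ u κ' u'))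
    (hM2 : ∀ (j : ℕ) (α κ : Fin 4) (u : Fin 4 → ℤ) (ρ : Fin 4) (w : Fin 4 → ℤ),
      M2Of 3 Lc mixFF j κ (bref α κ u) ρ (bref α ρ w) =
        (reflSign α κ * reflSign α ρ) • refK (Φ Lc α)
          (M2Of 3 Lc mixFF j κ u ρ w + conjV (M1At 3 Lc (toSite (ctrOff 4 Lc)) cΛ j ρ w) (diagK fun p c => γ j * ctGen 3 α Lc κ u p c)))
    (X2s : ℕ → Fin 4 → Fin 4 → (Fin 4 → ℤ) → Fin 4 → (Fin 4 → ℤ) → (Fin 4 → ℤ) → Fib 3 → ℝ)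
    (Δ : ℕ → Fin 4 → Fin 4 → (Fin 4 → ℤ) → Fin 4 → (Fin 4 → ℤ) → MKer 4 (Fib 3))
    (hsplit : ∀ (j : ℕ) (α μ : Fin 4) (y : Fin 4 → ℤ) (ν : Fin 4) (y' : Fin 4 → ℤ),
      W2OfK (coDressKBmAt (toSite (ctrOff 4 Lc)) Lc (KInvStep (d := 3) Lc j)) Lc
          (fun κ u => SpureRecAt 3 Lc (toSite (ctrOff 4 Lc)) ((Lc : ℝ) ^ 4) (-((Lc : ℝ) ^ 8 / 2)) cΛ j κ u +
            conjV (bhKStepAt 3 (toSite (ctrOff 4 Lc)) Lc j) (diagK fun p c => γ j * ctGen 3 α Lc κ u p c))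
          (M1At 3 Lc (toSite (ctrOff 4 Lc)) cΛ j)
          (fun κ u κ' u' => T2RecAt 3 Lc (toSite (ctrOff 4 Lc)) ((Lc : ℝ) ^ 4) (-((Lc : ℝ) ^ 8 / 2)) cΛ cE₂ cB T vh₂S mixFF j κ u κ' u' +
            conjW (bhKStepAt 3 (toSite (ctrOff 4 Lc)) Lc j)
              (SpureRecAt 3 Lc (toSite (ctrOff 4 Lc)) ((Lc : ℝ) ^ 4) (-((Lc : ℝ) ^ 8 / 2)) cΛ j κ u)
              (SpureRecAt 3 Lc (toSite (ctrOff 4 Lc)) ((Lc : ℝ) ^ 4) (-((Lc : ℝ) ^ 8 / 2)) cΛ j κ' u')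
              (diagK fun p c => γ j * ctGen 3 α Lc κ u p c) (diagK fun p c => γ j * ctGen 3 α Lc κ' u' p c) (diagK (h j α κ u κ' u')) +
            R2 j α κ u κ' u')
          (fun κ u ρ w => M2Of 3 Lc mixFF j κ u ρ w + conjV (M1At 3 Lc (toSite (ctrOff 4 Lc)) cΛ j ρ w) (diagK fun p c => γ j * ctGen 3 α Lc κ u p c))
          μ y ν y' =
        W2OfK (coDressKBmAt (toSite (ctrOff 4 Lc)) Lc (KInvStep (d := 3) Lc j)) Lc
            (SpureRecAt 3 Lc (toSite (ctrOff 4 Lc)) ((Lc : ℝ) ^ 4) (-((Lc : ℝ) ^ 8 / 2)) cΛ j) (M1At 3 Lc (toSite (ctrOff 4 Lc)) cΛ j)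
            (T2RecAt 3 Lc (toSite (ctrOff 4 Lc)) ((Lc : ℝ) ^ 4) (-((Lc : ℝ) ^ 8 / 2)) cΛ cE₂ cB T vh₂S mixFF j) (M2Of 3 Lc mixFF j) μ y ν y' +
          conjW (bhKStepAt 3 (toSite (ctrOff 4 Lc)) Lc j)
            (dM (coDressKBmAt (toSite (ctrOff 4 Lc)) Lc (KInvStep (d := 3) Lc j)) Lc
              (SpureRecAt 3 Lc (toSite (ctrOff 4 Lc)) ((Lc : ℝ) ^ 4) (-((Lc : ℝ) ^ 8 / 2)) cΛ j) (M1At 3 Lc (toSite (ctrOff 4 Lc)) cΛ j) μ y)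
            (dM (coDressKBmAt (toSite (ctrOff 4 Lc)) Lc (KInvStep (d := 3) Lc j)) Lc
              (SpureRecAt 3 Lc (toSite (ctrOff 4 Lc)) ((Lc : ℝ) ^ 4) (-((Lc : ℝ) ^ 8 / 2)) cΛ j) (M1At 3 Lc (toSite (ctrOff 4 Lc)) cΛ j) ν y')
            (diagK fun p c => ∑ κ, ∑' u, colH (coDressKBmAt (toSite (ctrOff 4 Lc)) Lc (KInvStep (d := 3) Lc j)) Lc μ y κ u * (γ j * ctGen 3 α Lc κ u p c))
            (diagK fun p c => ∑ κ, ∑' u, colH (coDressKBmAt (toSite (ctrOff 4 Lc)) Lc (KInvStep (d := 3) Lc j)) Lc ν y' κ u * (γ j * ctGen 3 α Lc κ u p c))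
            (diagK (X2s j α μ y ν y')) +
          Δ j α μ y ν y')
    (hDg : ∀ (j : ℕ) (α ν : Fin 4) (y' : Fin 4 → ℤ),
      Loc (dM (coDressKBmAt (toSite (ctrOff 4 Lc)) Lc (KInvStep (d := 3) Lc j)) Lc
        (fun κ u => SpureRecAt 3 Lc (toSite (ctrOff 4 Lc)) ((Lc : ℝ) ^ 4) (-((Lc : ℝ) ^ 8 / 2)) cΛ j κ u +
          conjV (bhKStepAt 3 (toSite (ctrOff 4 Lc)) Lc j) (diagK fun p c => γ j * ctGen 3 α Lc κ u p c))
        (M1At 3 Lc (toSite (ctrOff 4 Lc)) cΛ j) ν y'))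
    (hX2L : ∀ j α μ y ν y', Loc (diagK (X2s j α μ y ν y'))) (hΔL : ∀ j α μ y ν y', Loc (Δ j α μ y ν y'))
    (hΔ0 : ∀ j α μ y ν y', tadpole (coDressKBmAt (toSite (ctrOff 4 Lc)) Lc (KInvStep (d := 3) Lc j)) (Δ j α μ y ν y') = 0) :
    ∀ j : ℕ, AxisReflectionCovariant
      (flipK (TbalOf Lc (JsRecWAtOf (d := 3) hLc.pos (ctrOff_mem_box hLc.pos) ((Lc : ℝ) ^ 4) (-((Lc : ℝ) ^ 8 / 2)) cΛ cE₂ cB T hB hmix) j)) := by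
  have hL1 : 1 ≤ Lc := hLc.pos
  have hr := ctrOff_mem_box (d := 4) hL1
  rw [JsRecWAtOf_eq]
  have hRel := relInv_coDressKBmAt_KInvStep_bhKStepAt (d := 3) (Lc := Lc) hr
  have hn : 2 * (-((Lc : ℝ) ^ 8 / 2)) = -((Lc : ℝ) ^ 4 * (Lc : ℝ) ^ 4) := by ring
  have hlock : ∀ j, (Lc : ℝ) ^ 4 * wE 3 Lc (j + 1) * (γ j / (stepScale 3 Lc j * (Lc : ℝ) ^ 4 * wVH 3 Lc (j + 1))) = γ (j + 1) := by
    intro j; rw [hγ, hγ]; exact locks_of_pin (Lc := Lc) ((Lc : ℝ) ^ 4) (-((Lc : ℝ) ^ 8 / 2)) (pin_of_bcj (Lc := Lc) _ rfl) j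
  have hSp := SpureRecAt_bref hLc ((Lc : ℝ) ^ 4) (-((Lc : ℝ) ^ 8 / 2)) cΛ hn γ hγ hlock
  -- the localised difference of the two second symbols and its properties
  have hdiff : ∀ j α μ y ν y', Loc (diagK fun p a => X2s j α ν y' μ y p a - X2s j α μ y ν y' p a) := fun j α μ y ν y' => by
    rw [diagK_sub]; exact (hX2L j α ν y' μ y).sub (hX2L j α μ y ν y')
  have hEdiff : ∀ j α μ y ν y', comp (axEc (toSite (ctrOff 4 Lc)) Lc) (diagK fun p a => X2s j α ν y' μ y p a - X2s j α μ y ν y' p a) =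
      comp (diagK fun p a => X2s j α ν y' μ y p a - X2s j α μ y ν y' p a) (axEc (toSite (ctrOff 4 Lc)) Lc) :=
    fun j α μ y ν y' => comp_axEc_diagK_comm _ _ _
  refine axisReflectionCovariant_flipK_TbalOf_JsRecBmAtOf_ctrC_closed_bcj_rem hLc cΛ _ _ _ _ _
    (WrecAt_translate (toSite (ctrOff 4 Lc)) ((Lc : ℝ) ^ 4) (-((Lc : ℝ) ^ 8 / 2)) cΛ cE₂ cB T vh₂S mixFF hL1 hBt hmixt) γ hγ
    (fun j α μ y ν y' => diagK (X2s j α μ y ν y'))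
    (fun j α μ y ν y' => (1 / 2 : ℝ) • conjV (bhKStepAt 3 (toSite (ctrOff 4 Lc)) Lc j) (diagK fun p a => X2s j α ν y' μ y p a - X2s j α μ y ν y' p a) +
      (1 / 2 : ℝ) • (Δ j α μ y ν y' + Δ j α ν y' μ y))
    (fun j α μ y ν y' => hX2L j α μ y ν y') (fun j α μ y ν y' => comp_axEc_diagK_comm _ _ _)
    (fun j α μ y ν y' => loc_rem (loc_conjV (spr_bhKStepAt hr j) (hdiff j α μ y ν y')) (hΔL j α μ y ν y') (hΔL j α ν y' μ y))
    (fun j α μ y ν y' => tadpole_rem_eq_zero (spr_stepProp hr j) (loc_conjV (spr_bhKStepAt hr j) (hdiff j α μ y ν y')) (hΔL j α μ y ν y')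
      (hΔL j α ν y' μ y) (tadpole_conjV_rel_eq_zero (spr_stepProp hr j) (spr_bhKStepAt hr j) (spr_axEc _ _) (hRel j) (hdiff j α μ y ν y')
        (hEdiff j α μ y ν y')) (hΔ0 j α μ y ν y') (hΔ0 j α ν y' μ y))
    fun j α μ y ν y' => ?_
  -- the conjugated second-order law of the W-literal
  rw [JsRec0AtOf_W, JsRec0AtOf_S]
  show W2SymOfK _ Lc _ _ _ _ μ (bref α μ y) ν (bref α ν y') = _
  rw [W2SymOfK_bref_sharp (refK_coDressKBmAt_KInvStep (d := 3) hLc j α) (spr_stepProp hr j) (hSp j α) (M1At_bref (d := 3) hLc cΛ j α)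
      (hT2 j α) (hM2 j α) (hDg j α) μ y ν y',
    W2SymOfK_sharp_split_of (hsplit j α μ y ν y') (hsplit j α ν y' μ y), dM_SpureRecAt_M1At hr _ _ cΛ j μ y, dM_SpureRecAt_M1At hr _ _ cΛ j ν y',
    ← vertexOfK_smul_diagK_ctGen, ← vertexOfK_smul_diagK_ctGen]
  rfl

end Wall

end Summit.QuantumFields.BalabanUV.Beta.SpineRooted

end
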